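import Summits.BirchSwinnertonDyer.BirchSwinnertonDyer.Theorems.DefiniteThetaDerivedHeightCapTowerSqrtAnyPrimeGenerators
import Summits.BirchSwinnertonDyer.BirchSwinnertonDyer.Theorems.DefiniteThetaDerivedHeightCapTowerSqrtOddPrime
import HarnessLib

/-!
# Stub `stub_towerSqrt` of line «birth», crux `DerivedHeightCap` (stmt-BirchSwinnertonDyer-18438, route DefiniteTheta) — PROVED VERBATIM:
# the square root along the anticyclotomic tower for every number field `K` and EVERY prime `p` (including `p = 2`)

Route-independent `Theorems` file (cell `b2b-bsdres`, seat `b2b-bsdres-x10b`, gen 45), part 15 (final) of the series «tower square root».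
HONEST FRAMING: no curve asserted, no class closed, BSD not proved by any of this. What IS proved: the registered stub `stub_towerSqrt` of
the skeleton `Cruxes/DerivedHeightCap/Lines/birth.lean` (planner-skel, 2026-08-17), VERBATIM — for every number field `K`, every prime `p`,
every Brandt setup `S`, tower `T`, weights `φ`, `α ∈ ℤ_pˣ`:
`T.IsNormCompatible p φ α → ∀ ρ, (∀ n, θ_n^{ac} · ι θ_n^{ac} ∈ I_n^{2ρ}) → T.VanishesToOrderAc p φ α ρ`
(Bertolini–Darmon 2005 §1.2: "`L_p(E,K) = L_f L_f^* ∈ J^{2ρ} ⇒ L_f ∈ J^ρ`" in `Λ = ℤ_p⟦G_∞⟧`, finite-level form).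

Gen 44 proved it for `p ≠ 2` (`towerSqrt_of_ne_two`, part 10): a tower forces `[K:ℚ] = 1` (degenerate branch) or `K` imaginary quadratic
(part 9), and for `K` imaginary quadratic, `p` odd, the layer groups `Pic(𝒪_{p^{n+1}})/Δ` are cyclic `p`-groups with coherent generators and
unbounded orders (parts 5–7), so the abstract square root along a `ℤ_p`-tower (part 3, `p`-adic jets) applies. Parts 11–14 (this gen)
remove `p ≠ 2`: at `p = 2` Cox's two-step kernels are cyclic from level `2` on (`(1 + cω)² = X + 2cY₁ω`, `Y₁` odd, once `4 ∣ c`), the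
torsion `Δ` of `G̃_∞` injects from level `2` on, the generator transfer starts at `Q_3`, and levels `1, 2` are reached by restriction.

* §1 `towerSqrt_of_isImaginaryQuadratic_anyPrime` — `K` imaginary quadratic, every prime `p`.
* §2 `stub_towerSqrt` — the registered signature, by the dichotomy of part 9 (`[K:ℚ] = 1`: part 10 §3; else §1).

## References
* [BertoliniDarmon2005] §1.2 (18)–(21) and Cor. 3; [BertoliniDarmon1996] Prop. 2.7, §2.12; [Washington1997] §7.1, §13.2; [Cox2013] §7.D.
-/

noncomputable section

open scoped BigOperators

-- D-0017: single-problem summit, the namespace repeats the problem name by design.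
set_option linter.dupNamespace false

namespace Summit.BirchSwinnertonDyer.BirchSwinnertonDyer.Theorems.TowerSqrt

open Literature.NumberTheory.EllipticCurves Literature.NumberTheory.EllipticCurves.QuadOrderTower NumberField
  Literature.NumberTheory.Automorphic
open Summit.BirchSwinnertonDyer.BirchSwinnertonDyer.Theorems.DefmuSupersingularTheta (picRes_mem_torsionImage)

/-! ### §1 `K` imaginary quadratic, every prime `p` -/

-- see part 8: the stub-shaped statement needs a little more than the default instance budget in this import closure
set_option synthInstance.maxHeartbeats 40000 in
/-- **The square root along the anticyclotomic tower for `K` imaginary quadratic and EVERY prime `p`** (part 8 without `p ≠ 2`):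
for a norm-compatible tower of theta elements, `θ_n^{ac} · ι(θ_n^{ac}) ∈ I_n^{2ρ}` for every `n` implies `θ_n^{ac} ∈ I_n^{ρ}` for every `n`.
The layer groups `Q_{n+1} = Pic(𝒪_{p^{n+1}})/Δ` are finite cyclic `p`-groups with coherent generators (part 14 §1) and unbounded orders
(part 14 §2), `θ^{ac}` is coherent (BD96 Prop. 2.7 = `IsNormCompatible`), and part 3 applies.
[cite: BertoliniDarmon2005, §1.2 (18)–(21) and Cor. 3] [cite: BertoliniDarmon1996, Prop. 2.7 and §2.12] -/
theorem towerSqrt_of_isImaginaryQuadratic_anyPrime :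
    ∀ (K : Type) [Field K] [NumberField K] (p : ℕ) [Fact p.Prime] (Nplus Nminus : ℕ)
      (S : Literature.NumberTheory.Automorphic.Brandt.XiSetup Nplus Nminus)
      (T : Literature.NumberTheory.EllipticCurves.GrossPointTower K S p)
      (φ : Literature.NumberTheory.Automorphic.Brandt.ClassSet S.O → ℤ) (α : ℤ_[p]ˣ),
      IsImaginaryQuadratic K → T.IsNormCompatible p φ α → ∀ ρ : ℕ,
      (∀ n : ℕ, T.thetaAc p φ α n * MonoidAlgebra.mapDomain (fun σ => σ⁻¹) (T.thetaAc p φ α n) ∈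
        Literature.NumberTheory.EllipticCurves.augIdeal ℤ_[p] (Literature.NumberTheory.EllipticCurves.AcLayerGroup K p (n + 1)) ^
          (2 * ρ)) →
      T.VanishesToOrderAc p φ α ρ := by
  intro K _ _ p _ Nplus Nminus S T φ α hK hnc ρ hyp
  classical
  -- local instances: keep the typeclass search for the quotients away from `IsCyclic.isMulCommutative`
  haveI : ∀ m : ℕ, IsMulCommutative (ClassGroup (quadOrder K (p ^ m))) := fun m => CommMagma.to_isCommutative
  -- (1) the tower data: maps, coherent generators, orders
  have hle : ∀ n : ℕ, torsionImage K p (n + 1 + 1) ≤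
      (torsionImage K p (n + 1)).comap (picRes K (pow_dvd_pow p (n + 1).le_succ)) :=
    fun n t ht => Subgroup.mem_comap.mpr (picRes_mem_torsionImage p (n + 1).le_succ ht)
  let π : ∀ n : ℕ, AcLayerGroup K p (n + 1 + 1) →* AcLayerGroup K p (n + 1) := fun n =>
    QuotientGroup.map _ _ (picRes K (pow_dvd_pow p (n + 1).le_succ)) (hle n)
  obtain ⟨d, hdres, hdgen⟩ := exists_coherent_generators_mod_torsionImage_anyPrime p hK
  let γ : ∀ n : ℕ, AcLayerGroup K p (n + 1) := fun n => QuotientGroup.mk' (torsionImage K p (n + 1)) (d n)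
  have hγ : ∀ n, π n (γ (n + 1)) = γ n := by
    intro n
    simp only [π, γ]
    rw [QuotientGroup.mk'_apply, QuotientGroup.map_mk, hdres]
    rfl
  have hgen : ∀ n (q : AcLayerGroup K p (n + 1)), ∃ k : ℕ, γ n ^ k = q := by
    intro n q
    obtain ⟨x, rfl⟩ := QuotientGroup.mk'_surjective (torsionImage K p (n + 1)) q
    obtain ⟨i, hi⟩ := hdgen n x
    refine ⟨i, ?_⟩
    simp only [γ]
    rw [← map_pow, QuotientGroup.mk'_apply, QuotientGroup.mk'_apply, QuotientGroup.eq]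
    have : (d n ^ i)⁻¹ * x = x * (d n ^ i)⁻¹ := mul_comm _ _
    rw [this]; exact hi
  have hfin : ∀ n, Finite (AcLayerGroup K p (n + 1)) := fun n => by
    haveI : Finite (ClassGroup (quadOrder K (p ^ (n + 1)))) := finite_classGroup (K := K) _
    exact Finite.of_surjective _ (QuotientGroup.mk'_surjective (torsionImage K p (n + 1)))
  choose e he hne using fun n => exists_natCard_acLayerGroup_eq_anyPrime p hK n
  have he_unb : ∀ N : ℕ, ∃ n, N ≤ e n := fun N => ⟨N + 1, by have := hne (N + 1); omega⟩
  -- (2) θ^{ac} is coherent along π (from the norm-compatibility of θ)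
  have hθ : ∀ n, MonoidAlgebra.mapDomainRingHom ℤ_[p] (π n) (T.thetaAc p φ α (n + 1)) = T.thetaAc p φ α n := by
    intro n
    have hn := (mem_completedGroupRing_iff (K := K) (p := p)).mp hnc n
    show MonoidAlgebra.mapDomainRingHom ℤ_[p] (π n)
        (MonoidAlgebra.mapDomainRingHom ℤ_[p] (acProj K p (n + 1 + 1)) (T.theta p φ α (n + 1))) =
      MonoidAlgebra.mapDomainRingHom ℤ_[p] (acProj K p (n + 1)) (T.theta p φ α n)
    rw [← hn, groupRingProj, ← RingHom.comp_apply, ← RingHom.comp_apply, ← MonoidAlgebra.mapDomainRingHom_comp,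
      ← MonoidAlgebra.mapDomainRingHom_comp]
    congr 2
  -- (3) the abstract square root along the tower
  intro n
  exact mem_augIdeal_pow_of_mul_inv_mem p (G := fun n => AcLayerGroup K p (n + 1)) hfin π γ hγ hgen e he he_unb
    (fun n => T.thetaAc p φ α n) hθ ρ hyp n

end Summit.BirchSwinnertonDyer.BirchSwinnertonDyer.Theorems.TowerSqrt

/-! ### §2 The registered stub, verbatim -/

namespace Summit.BirchSwinnertonDyer.BirchSwinnertonDyer.Theorems.DerivedHeightCapTowerSqrt

open Summit.BirchSwinnertonDyer.BirchSwinnertonDyer.Theorems.TowerSqrt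

-- see part 8: the stub-shaped statement needs a little more than the default instance budget in this import closure
set_option synthInstance.maxHeartbeats 40000 in
/-- **Stub `stub_towerSqrt` of line «birth» (crux `DerivedHeightCap`), verbatim** — the square root along the anticyclotomic tower for
EVERY number field `K` and EVERY prime `p`: if the theta elements of a tower of Gross points are norm-compatible and
`θ_n^{ac} · ι(θ_n^{ac}) ∈ I_n^{2ρ}` in `ℤ_p[Pic(𝒪_{p^{n+1}})/Δ]` for every `n`, then `θ_n^{ac} ∈ I_n^ρ` for every `n`
(`T.VanishesToOrderAc p φ α ρ`). A tower forces `[K:ℚ] = 1` (degenerate branch, part 10) or `K` imaginary quadratic (§1), by part 9.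
[cite: BertoliniDarmon2005, §1.2 (18)–(21) and Cor. 3] [cite: BertoliniDarmon1996, Prop. 2.7 and §2.12] -/
theorem stub_towerSqrt :
    ∀ (K : Type) [Field K] [NumberField K] (p : ℕ) [Fact p.Prime] (Nplus Nminus : ℕ) (S : Literature.NumberTheory.Automorphic.Brandt.XiSetup Nplus Nminus) (T : Literature.NumberTheory.EllipticCurves.GrossPointTower K S p) (φ : Literature.NumberTheory.Automorphic.Brandt.ClassSet S.O → ℤ) (α : ℤ_[p]ˣ), T.IsNormCompatible p φ α → ∀ ρ : ℕ, (∀ n : ℕ, T.thetaAc p φ α n * MonoidAlgebra.mapDomain (fun σ => σ⁻¹) (T.thetaAc p φ α n) ∈ Literature.NumberTheory.EllipticCurves.augIdeal ℤ_[p] (Literature.NumberTheory.EllipticCurves.AcLayerGroup K p (n + 1)) ^ (2 * ρ)) → T.VanishesToOrderAc p φ α ρ := by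
  intro K _ _ p _ Nplus Nminus S T φ α hnc ρ hyp
  rcases finrank_eq_one_or_isImaginaryQuadratic_of_grossPointTower S T with h1 | hK
  · exact towerSqrt_of_finrank_eq_one K p Nplus Nminus S T φ α h1 hnc ρ hyp
  · exact towerSqrt_of_isImaginaryQuadratic_anyPrime K p Nplus Nminus S T φ α hK hnc ρ hyp

end Summit.BirchSwinnertonDyer.BirchSwinnertonDyer.Theorems.DerivedHeightCapTowerSqrt

end
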